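import Mathlib
import Literature.Computability.AlgebraicComplexity.GroupTheoreticMatMul
import Summits.MatrixMultiplication.MatrixMultiplication.Theses.ThinBlockAlpha

/-!
# Negative lemma for crux `ThinPackings` (stmt-MatrixMultiplication-10595): vertical-multiplier ruled-graph designs are capped at the coset bound

Crux-triage round 1 (triager 3) kill of the transferred statement C⁺ = `RuledGraphThinDesigns` of
idea card `Cruxes/ThinPackings/Ideas/ruled-graph-thin-designs.md` (its Lean form is
`Cruxes/ThinPackings/Ideator1Sketch.lean`, namespace `…Cruxes.ThinPackings.RuledGraph`).  The design:
host `H = (ZMod q × ZMod q) × V`, long legs the graphs `A i = {(x • d i, f i x)}`,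
`C i = {(y • e i, g i y)}` over lines of the plane through the origin, short legs vertical
`B i = {0} × W i`; the card's `Condition d e f g W` is the tree's `IsSTPP` clause written in these
coordinates.  Statements here are DEF-FREE: the hypothesis of `ruledGraph_sum_card_le` is the body of
`Condition` verbatim, and `not_ruledGraphThinDesigns` negates the body of `RuledGraphThinDesigns`
verbatim (so `Iff.rfl`/`exact` transports them to the sketch's named forms).

* `ruledGraph_sum_card_le` — `Condition → Σ_i |W i| ≤ |V|`: all A-lines pass over the plane origin,
  and the clause at `j = k`, `x = x' = 0`, `y = y'` says the sets `f i 0 − W i` are pairwise disjoint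
  in `V` (the `A − B` packing read in the fibre over the origin).  This is the card's "VM-cap
  conjecture" (its cheapest falsifier F1) with constant `1`.
* `ruledGraph_mul_le` — with `|W i| = M` for all `i`: `L · M ≤ |V|`, i.e. `|H| = q²|V| ≥ L·q²·M =
  L·N²·M`, the coset bound that thin packings must beat by `M·N^{−η}`.
* `not_ruledGraphThinDesigns` — hence C⁺ is false at every `(a, η)` with `η < a`
  (witness `a = 1/2`, `η = 1/4`: `M ≤ q^{1/4} < q^{1/2} ≤ M`).
Conclusions assert no Theses decl positively (negative-side lemmas, `--supports` the crux item).
-/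

open Literature.Computability.AlgebraicComplexity Finset

namespace Summit.MatrixMultiplication.MatrixMultiplication.Theorems.ThinPackings.Negative

/-- **Vertical-multiplier cap.**  If ruled-graph data `(d, e, f, g, W)` over the plane
`ZMod q × ZMod q` with value group `V` satisfy the card's `Condition` (hypothesis `h`, verbatim),
then `Σ_i |W i| ≤ |V|`: the map `(i, w) ↦ f i 0 − w` is injective on `⨆ᵢ W i` by the clause at
`j = k`, `x = x' = 0`, `y = y' = 0`. [new, elementary] -/
theorem ruledGraph_sum_card_le {q : ℕ} {V : Type} [AddCommGroup V] [Fintype V] {L : ℕ}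
    (d e : Fin L → ZMod q × ZMod q) (f g : Fin L → ZMod q → V) (W : Fin L → Finset V)
    (h : ∀ i j k : Fin L, ∀ x x' y y' : ZMod q, ∀ w ∈ W i, ∀ w' ∈ W j,
      (x' • d i - x • d k) + (y' • e k - y • e j) = 0 →
      (f i x' - f k x) + (w' - w) + (g k y' - g j y) = 0 →
      i = j ∧ j = k ∧ x = x' ∧ y = y' ∧ w = w') :
    ∑ i, (W i).card ≤ Fintype.card V := by
  classical
  have hinj : Set.InjOn (fun x : (Σ _ : Fin L, V) => f x.1 0 - x.2)
      ↑(Finset.univ.sigma W) := by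
    rintro ⟨i, w⟩ hx ⟨k, w'⟩ hy hxy
    simp only [coe_sigma, Set.mem_sigma_iff, coe_univ, Set.mem_univ, true_and, mem_coe] at hx hy
    change f i 0 - w = f k 0 - w' at hxy
    have hplane : ((0 : ZMod q) • d i - (0 : ZMod q) • d k) +
        ((0 : ZMod q) • e k - (0 : ZMod q) • e k) = 0 := by
      simp
    have hval : (f i 0 - f k 0) + (w' - w) + (g k 0 - g k 0) = 0 := by
      have : (f i 0 - f k 0) + (w' - w) + (g k 0 - g k 0) = (f i 0 - w) - (f k 0 - w') := by
        abel
      rw [this, hxy, sub_self]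
    obtain ⟨hik, -, -, -, hw⟩ := h i k k 0 0 0 0 w hx w' hy hplane hval
    subst hik
    subst hw
    rfl
  calc ∑ i, (W i).card = (Finset.univ.sigma W).card := by rw [card_sigma]
    _ = ((Finset.univ.sigma W).image fun x : (Σ _ : Fin L, V) => f x.1 0 - x.2).card :=
        (card_image_of_injOn hinj).symm
    _ ≤ Fintype.card V := card_le_univ _

/-- **The coset bound for vertical-multiplier ruled-graph designs**: under `Condition` with all
`|W i| = M`, `L · M ≤ |V|` (so `|H| = q²|V| ≥ L · q² · M = L · N² · M`). [new, elementary] -/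
theorem ruledGraph_mul_le {q : ℕ} {V : Type} [AddCommGroup V] [Fintype V] {L M : ℕ}
    (d e : Fin L → ZMod q × ZMod q) (f g : Fin L → ZMod q → V) (W : Fin L → Finset V)
    (h : ∀ i j k : Fin L, ∀ x x' y y' : ZMod q, ∀ w ∈ W i, ∀ w' ∈ W j,
      (x' • d i - x • d k) + (y' • e k - y • e j) = 0 →
      (f i x' - f k x) + (w' - w) + (g k y' - g j y) = 0 →
      i = j ∧ j = k ∧ x = x' ∧ y = y' ∧ w = w')
    (hW : ∀ i, (W i).card = M) : L * M ≤ Fintype.card V := by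
  have hsum := ruledGraph_sum_card_le d e f g W h
  rwa [Finset.sum_congr rfl (fun i _ => hW i), sum_const, card_univ, Fintype.card_fin,
    smul_eq_mul] at hsum

/-- **The card's C⁺ `RuledGraphThinDesigns` is false** (its body negated verbatim): at `a = 1/2`,
`η = 1/4` any witness would have `q² · L · M ≤ q²|V| ≤ L · q^{9/4}`, i.e. `M ≤ q^{1/4}`, against
`q^{1/2} ≤ M` and `q ≥ 2`.  The same computation refutes every `(a, η)` with `η < a`: the
vertical-multiplier ruled-graph template certifies at best the trivial `|H| ≳ L·N²·M`.
[new, elementary] -/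
theorem not_ruledGraphThinDesigns :
    ¬ (∀ a : ℝ, 0 ≤ a → a < 1 → ∀ η : ℝ, 0 < η →
      ∃ (q : ℕ) (_ : NeZero q) (V : Type) (_ : AddCommGroup V) (_ : Fintype V) (_ : DecidableEq V)
        (L M : ℕ) (d e : Fin L → ZMod q × ZMod q) (f g : Fin L → ZMod q → V)
        (W : Fin L → Finset V),
        2 ≤ q ∧ (∀ i, (W i).Nonempty) ∧
        (∀ i j k : Fin L, ∀ x x' y y' : ZMod q, ∀ w ∈ W i, ∀ w' ∈ W j,
          (x' • d i - x • d k) + (y' • e k - y • e j) = 0 →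
          (f i x' - f k x) + (w' - w) + (g k y' - g j y) = 0 →
          i = j ∧ j = k ∧ x = x' ∧ y = y' ∧ w = w') ∧
        (∀ i, (W i).card = M) ∧ (q : ℝ) ^ a ≤ M ∧
        (q : ℝ) ^ 2 * Fintype.card V ≤ L * (q : ℝ) ^ (2 + η)) := by
  intro h
  obtain ⟨q, _, V, _, _, _, L, M, d, e, f, g, W, hq, -, hcond, hW, hM, hP⟩ :=
    h (1 / 2) (by norm_num) (by norm_num) (1 / 4) (by norm_num)
  have hLM : L * M ≤ Fintype.card V := ruledGraph_mul_le d e f g W hcond hW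
  have hLMr : (L : ℝ) * M ≤ Fintype.card V := by exact_mod_cast hLM
  have hq2 : (2 : ℝ) ≤ q := by exact_mod_cast hq
  have hq1 : (1 : ℝ) < q := by linarith
  have hqpos : (0 : ℝ) < q := by linarith
  have hVpos : (0 : ℝ) < Fintype.card V := by exact_mod_cast Fintype.card_pos
  have hLpos : (0 : ℝ) < L := by
    by_contra hL
    push Not at hL
    have hL0 : (L : ℝ) = 0 := le_antisymm hL (Nat.cast_nonneg L)
    rw [hL0, zero_mul] at hP
    have : (0 : ℝ) < (q : ℝ) ^ 2 * Fintype.card V := by positivity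
    linarith
  have h1 : (q : ℝ) ^ 2 * ((L : ℝ) * M) ≤ L * (q : ℝ) ^ (2 + 1 / 4 : ℝ) :=
    (mul_le_mul_of_nonneg_left hLMr (by positivity)).trans hP
  have h2 : (q : ℝ) ^ 2 * (M : ℝ) ≤ (q : ℝ) ^ (2 + 1 / 4 : ℝ) := by
    have h1' : (L : ℝ) * ((q : ℝ) ^ 2 * M) ≤ L * (q : ℝ) ^ (2 + 1 / 4 : ℝ) := by
      calc (L : ℝ) * ((q : ℝ) ^ 2 * M) = (q : ℝ) ^ 2 * ((L : ℝ) * M) := by ring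
        _ ≤ L * (q : ℝ) ^ (2 + 1 / 4 : ℝ) := h1
    exact le_of_mul_le_mul_left h1' hLpos
  have h3 : (q : ℝ) ^ (2 + 1 / 4 : ℝ) = (q : ℝ) ^ 2 * (q : ℝ) ^ (1 / 4 : ℝ) := by
    rw [Real.rpow_add hqpos, Real.rpow_two]
  rw [h3] at h2
  have h4 : (M : ℝ) ≤ (q : ℝ) ^ (1 / 4 : ℝ) := le_of_mul_le_mul_left h2 (by positivity)
  have h5 : (q : ℝ) ^ (1 / 4 : ℝ) < (q : ℝ) ^ (1 / 2 : ℝ) :=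
    Real.rpow_lt_rpow_of_exponent_lt hq1 (by norm_num)
  linarith

end Summit.MatrixMultiplication.MatrixMultiplication.Theorems.ThinPackings.Negative
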